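import Summits.HodgeConjecture.HodgeConjecture.Theorems.CyclicUnitaryPowersFiveFactsPrime
import Summits.HodgeConjecture.HodgeConjecture.Theorems.CyclicUnitaryPowersPLPackageOfNodalMeridian
import Summits.HodgeConjecture.HodgeConjecture.Theorems.CyclicUnitaryPowersEigenHodgeNumbersOfTwoNumbers
import Literature.AlgebraicGeometry.HodgeTheory.UnitaryReflectionGroupZariskiDenseHolds
import Literature.AlgebraicGeometry.HodgeTheory.CyclicCoverDeckInvariantsTransfer
import Literature.AlgebraicGeometry.HodgeTheory.CyclicCoverUniversalFamily

/-!
# Route `CyclicUnitaryPowers`, crux K1-A `VeryGeneralDeckCommutatorsInHg` (stmt-HodgeConjecture-19544) with the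
# eigen-Hodge binder CT2 REPLACED by two printed NUMBERS (the geometric genus and `b₂` of a smooth degree-`p` surface)

Registry v12 reads `K1 ⟸ {F1° = carlsonToledo1999_nodalMeridianMonodromy_isCyclicReflection,
CT2 = carlsonToledo1999_finrank_eigenspace_inf_hodgePiece, CDK = cmsp_nonHodgeGenericPoints_countable_algebraic_cover}`.
CT2 (all eigen-Hodge numbers of the deck transformation; Carlson–Toledo §5 with Griffiths' residues at pole orders 1–3)
is now a THEOREM at prime `p ≥ 5` modulo two numerical print facts
(`CyclicUnitaryPowersEigenHodgeNumbersOfTwoNumbers.finrank_eigenspace_inf_hodgePiece_prime_of_facts`): the geometric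
genus `h^{n,0}(X_F) = C(d−1,n+1)` (`Arapura2012_hypersurface_geometricGenus` =: PG, whose `≥` half is proved) and
`b₂ = d³ − 4d² + 6d − 2` (`EisenbudHarris2016_surface_secondBettiNumber` =: B2). This file re-runs lane A's
composition (seat Ax's prime-only junction `CyclicUnitaryPowersFiveFactsPrime`) with that theorem in place of CT2:

* `cyclicDeckHodge_of_printNumbers` — the registered stub `stub_cyclicDeckHodge` (clauses (iii)–(iv) of `Deck`,
  signature verbatim) from PG + B2 (the invariant line (iii) is the theorem
  `carlsonToledo1999_finrank_eigenspace_deck_one_holds`);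
* `veryGeneralDeckCommutatorsInHg_of_deckHodge_prime` — `veryGeneralDeckCommutatorsInHg_of_five_facts_prime` with
  the Deck clauses SUPPLIED as a hypothesis instead of being derived from CT1/CT2 (proof otherwise verbatim): the
  junction any future re-cut of either side can plug into;
* `veryGeneralDeckCommutatorsInHg_of_prime_family_printNumbers` — K1 ⟸ {Carlson–Toledo family at primes, PG, B2, CDK};
* `veryGeneralDeckCommutatorsInHg_of_nodalMeridian_printNumbers` — **K1-A ⟸ {F1°, PG, B2, CDK}**, and the leaf twin
  `cyclicSurfacePowersHodge_of_nodalMeridian_printNumbers`. (With seat Ax's F1† — the `σ`-free local monodromy —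
  feeding the prime family, the same junction gives `K1 ⟸ {F1†, PG, B2, CDK}`.)

CONDITIONAL; rung F-H1 not moved; nothing here says HC ∕ HC_AV is proved. References: Carlson–Toledo, Duke Math. J.
97 (1999) §§2, 5, 6, 7; Arapura (2012) §17.3 (17.3.1); Eisenbud–Harris (2016) Example 5.24; Cattani–Deligne–Kaplan
(1995) Thm. 1.1; Carlson–Müller-Stach–Peters (2017) 15.3.7.
-/

noncomputable section

set_option linter.dupNamespace false

namespace Summit.HodgeConjecture.HodgeConjecture.Theorems.CyclicUnitaryPowersK1OfPrintNumbers

open Literature.AlgebraicGeometry.Motives Literature.AlgebraicGeometry.HodgeTheory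
open Literature.AlgebraicGeometry.HodgeTheory.BettiUniverse
open Literature.AlgebraicTopology.SingularHomology
open CategoryTheory
open Summit.HodgeConjecture.HodgeConjecture.Theorems.CyclicUnitaryPowersDeckModelClauses
open Summit.HodgeConjecture.HodgeConjecture.Theorems.CyclicUnitaryPowersFiveFacts
open Summit.HodgeConjecture.HodgeConjecture.Theorems.CyclicUnitaryPowersFiveFactsPrime
open Summit.HodgeConjecture.HodgeConjecture.Theorems.CyclicUnitaryPowersDeckHodgeOfCarlsonToledo (hilbert_jacobianIdeal_eq_cube_getD)
open Summit.HodgeConjecture.HodgeConjecture.Theorems.CyclicUnitaryPowersEigenHodgeNumbersOfTwoNumbers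
  (finrank_eigenspace_inf_hodgePiece_prime_of_facts)

/- The registered `let`-prefix binds `pmul`; after `intro` it is only used through `ehn`. -/
set_option linter.unusedVariables false in
/-- **`stub_cyclicDeckHodge` (clauses (iii)–(iv) of `Deck`; registered signature of line `unitary-reflection-zariski`,
VERBATIM) from the two numerical print facts**: (iii) is the theorem `carlsonToledo1999_finrank_eigenspace_deck_one_holds`;
(iv) at `ζ = e^{2πi/p}` is `finrank_eigenspace_inf_hodgePiece_prime_of_facts` (CT2 at prime `p ≥ 5`, PROVED modulo
the geometric genus and `b₂`), evaluated by Macaulay (`hilbert_jacobianIdeal_eq_cube_getD`: `dim R_f^a` is the route's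
`ehn`). [cite: CarlsonToledo1999, §2 (held text p0005) and §5 (held text p0011–p0012)]
[cite: Arapura2012, §17.3 (17.3.1)] [cite: EisenbudHarris2016, Example 5.24 and Table 5.1] -/
theorem cyclicDeckHodge_of_printNumbers
    (hA : Arapura2012_hypersurface_geometricGenus) (hB : EisenbudHarris2016_surface_secondBettiNumber) :
    open Literature.AlgebraicGeometry.Motives Literature.AlgebraicGeometry.HodgeTheory Literature.AlgebraicGeometry.HodgeTheory.BettiUniverse CategoryTheory.Limits in let pmul : List ℕ → List ℕ → List ℕ := fun a b => (List.range (a.length + b.length - 1)).map fun k => ((List.range (k + 1)).map fun i => a.getD i 0 * b.getD (k - i) 0).sum; let ehn : ℕ → ℕ → ℕ → ℕ := fun p j q => if (q + 1) * p < 3 + j then 0 else ((List.replicate 3 (List.replicate (p - 1) 1)).foldl pmul [1]).getD ((q + 1) * p - 3 - j) 0; ∀ ⦃p : ℕ⦄, p.Prime → 7 ≤ p → ∀ f : MvPolynomial (Fin 3) ℂ, f.IsHomogeneous p → f ≠ 0 → ∀ (hXF : IsSmoothProjective 2 (SmoothHypersurface.hypersurface (MvPolynomial.X (Fin.last 3)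 ^ p - MvPolynomial.rename Fin.castSucc f))) (ha : (fun i : Fin 4 => if i = Fin.last 3 then (Units.mk0 (Complex.exp (2 * (Real.pi : ℂ) * Complex.I / (p : ℂ))) (Complex.exp_ne_zero _)) else 1) ∈ diagonalStabilizer (MvPolynomial.X (Fin.last 3) ^ p - MvPolynomial.rename Fin.castSucc f)), Module.finrank ℚ ↥(Module.End.eigenspace (pull (diagonalAut (MvPolynomial.X (Fin.last 3) ^ p - MvPolynomial.rename Fin.castSucc f) ha) 2) 1) = 1 ∧ ∃ ζ : ℂ, IsPrimitiveRoot ζ p ∧ ∀ j q : ℕ, 1 ≤ j → j < p → q ≤ 2 → Module.finrank ℂ ↥(Module.End.eigenspace ((pull (diagonalAut (MvPolynomial.X (Fin.last 3) ^ p - MvPolynomial.rename Fin.castSucc f) ha) 2).baseChange ℂ) (ζ ^ j) ⊓ (hodge exists_isReal_hodgeModel_holds hXF 2).piece ((2 : ℤ) - q) q) = ehn p j q := by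
  intro pmul ehn p hp h7 f hf hf0 hXF ha
  have hp3 : 3 ≤ p := by omega
  refine ⟨carlsonToledo1999_finrank_eigenspace_deck_one_holds hp3 f hf hf0 hXF ha,
    Complex.exp (2 * (Real.pi : ℂ) * Complex.I / (p : ℂ)), Complex.isPrimitiveRoot_exp p (by omega),
    fun j q hj hjp hq ↦ ?_⟩
  refine (finrank_eigenspace_inf_hodgePiece_prime_of_facts hA hB exists_isReal_hodgeModel_holds hp (by omega)
    f hf hf0 hXF ha j q hj hjp hq).trans ?_
  simp only [ehn, pmul]
  split_ifs with hlt
  · rfl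
  · exact hilbert_jacobianIdeal_eq_cube_getD (by omega) hf hf0 hXF _

/-- **K1 at primes from the Deck clauses as a hypothesis** — seat Ax's `veryGeneralDeckCommutatorsInHg_of_five_facts_prime`
with the model clauses (iii)–(iv) of `Deck` (the registered `stub_cyclicDeckHodge` signature) SUPPLIED rather than derived
from CT1/CT2; otherwise verbatim (CDK cover of the non-Hodge-generic points, CMSP 15.3.7 (i) for the Carlson–Toledo family
at the prime `p`, B2 density of the commutator, B1 commutators of `MT` in `Hg`, transport).
[cite: CarlsonToledo1999, §2 and §7 Theorem 7.1] [cite: CarlsonMullerStachPeters2017, Lemma–Definition 15.3.7] -/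
theorem veryGeneralDeckCommutatorsInHg_of_deckHodge_prime
    (hCT : ∀ ⦃p : ℕ⦄, p.Prime → 7 ≤ p → Nonempty (CarlsonToledoFamily p))
    (hDeckH : open Literature.AlgebraicGeometry.Motives Literature.AlgebraicGeometry.HodgeTheory Literature.AlgebraicGeometry.HodgeTheory.BettiUniverse CategoryTheory.Limits in let pmul : List ℕ → List ℕ → List ℕ := fun a b => (List.range (a.length + b.length - 1)).map fun k => ((List.range (k + 1)).map fun i => a.getD i 0 * b.getD (k - i) 0).sum; let ehn : ℕ → ℕ → ℕ → ℕ := fun p j q => if (q + 1) * p < 3 + j then 0 else ((List.replicate 3 (List.replicate (p - 1) 1)).foldl pmul [1]).getD ((q + 1) * p - 3 - j) 0; ∀ ⦃p : ℕ⦄, p.Prime → 7 ≤ p → ∀ f : MvPolynomial (Fin 3) ℂ, f.IsHomogeneous p → f ≠ 0 → ∀ (hXF : IsSmoothProjective 2 (SmoothHypersurface.hypersurface (MvPolynomial.X (Fin.last 3) ^ p - MvPolynomial.rename Fin.castSucc f))) (ha : (fun i : Fin 4 => if i = Fin.last 3 then (Units.mk0 (Complex.exp (2 * (Real.pi : ℂ)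 * Complex.I / (p : ℂ))) (Complex.exp_ne_zero _)) else 1) ∈ diagonalStabilizer (MvPolynomial.X (Fin.last 3) ^ p - MvPolynomial.rename Fin.castSucc f)), Module.finrank ℚ ↥(Module.End.eigenspace (pull (diagonalAut (MvPolynomial.X (Fin.last 3) ^ p - MvPolynomial.rename Fin.castSucc f) ha) 2) 1) = 1 ∧ ∃ ζ : ℂ, IsPrimitiveRoot ζ p ∧ ∀ j q : ℕ, 1 ≤ j → j < p → q ≤ 2 → Module.finrank ℂ ↥(Module.End.eigenspace ((pull (diagonalAut (MvPolynomial.X (Fin.last 3) ^ p - MvPolynomial.rename Fin.castSucc f) ha) 2).baseChange ℂ) (ζ ^ j) ⊓ (hodge exists_isReal_hodgeModel_holds hXF 2).piece ((2 : ℤ) - q) q) = ehn p j q)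
    (hCT71 : carlsonToledo1999_unitaryReflection_zariskiDense)
    (hCDK : cmsp_nonHodgeGenericPoints_countable_algebraic_cover) :
    Summit.HodgeConjecture.HodgeConjecture.Theses.CyclicUnitaryPowers.VeryGeneralDeckCommutatorsInHg := by
  refine Summit.HodgeConjecture.HodgeConjecture.Theorems.CyclicUnitaryPowersModelTransfer.stub_cyclicModelTransfer ?_
  intro p hp h7
  obtain ⟨𝔉⟩ := hCT hp h7
  haveI hHTF : HodgeTensorFacts.{0, 0} := hodgeTensorFacts_holds
  haveI : ∀ t : ComplexPoints 𝔉.S, Module.Finite ℚ (bettiCohomology (fiberOver 𝔉.u t) 2) := fun t => 𝔉.finite t 2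
  -- real (hence Hodge-symmetric) Hodge models of the fibres
  have hAm := fun t : ComplexPoints 𝔉.S =>
    exists_isReal_hodgeModel_holds.exists_isHodgeSymmetric (𝔉.isSmoothProjectiveFamily.isSmoothProjective t)
  let A : ∀ t : ComplexPoints 𝔉.S, HodgeModel 2 (fiberOver 𝔉.u t) := fun t => (hAm t).choose
  have hA : ∀ t, (A t).IsHodgeSymmetric := fun t => (hAm t).choose_spec
  -- the Cattani–Deligne–Kaplan cover of the non-Hodge-generic points of the base
  obtain ⟨W, hW, hcov⟩ := hCDK 𝔉.u 2 2 𝔉.isSmoothProjectiveFamily 𝔉.isQuasiProjectiveOver 𝔉.smooth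
    𝔉.irreducibleSpace 𝔉.locallyTrivial A hA
  -- each member of the cover is avoided off one nonzero polynomial condition on the coefficients
  choose G hG₀ hG using fun j => 𝔉.alg (W j) (hW j).1 (hW j).2
  -- the bad family: the coordinate `a_(x₀^p)` (forcing `f ≠ 0`) followed by the `G j`
  have hdeg : (Finsupp.single (0 : Fin 3) p).degree = p := by simp [Finsupp.degree_single]
  refine ⟨fun i => if i = 0 then MvPolynomial.X ⟨Finsupp.single 0 p, hdeg⟩ else G (i - 1), ?_, ?_⟩
  · intro i
    by_cases hi : i = 0
    · subst hi
      refine ⟨MvPolynomial.X 0 ^ p, by simpa using (MvPolynomial.isHomogeneous_X ℂ (0 : Fin 3)).pow p, ?_⟩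
      simp [MvPolynomial.coeff_X_pow]
    · simpa only [hi, if_false] using hG₀ (i - 1)
  intro f hf hgen' hXF ha
  have hf0 : f ≠ 0 := by
    rintro rfl
    exact hgen' 0 (by simp)
  have hgen : ∀ j, MvPolynomial.eval (fun d : {d : Fin 3 →₀ ℕ // d.degree = p} => f.coeff d.1) (G j) ≠ 0 :=
    fun j => by simpa only [Nat.succ_ne_zero, if_false, Nat.add_sub_cancel] using hgen' (j + 1)
  -- the deck clauses on the model: (o)–(ii) routine (landed), (iii)–(iv) from the Carlson–Toledo facts
  obtain ⟨ha', h1, h2⟩ := exists_cyclicDeckModel_clauses_one_two hp.ne_zero f hXF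
  obtain ⟨h3, h4⟩ := hDeckH hp h7 f hf hf0 hXF ha
  have h1' : pull (diagonalAut (MvPolynomial.X (Fin.last 3) ^ p - MvPolynomial.rename Fin.castSucc f) ha) 2 ^ p = 1 := by
    rw [diagonalAut_congr _ ha ha' rfl]; exact h1
  have h2' : ∀ x y, tr hXF (2 + 2) (cup _ 2 2
      (pull (diagonalAut (MvPolynomial.X (Fin.last 3) ^ p - MvPolynomial.rename Fin.castSucc f) ha) 2 x)
      (pull (diagonalAut (MvPolynomial.X (Fin.last 3) ^ p - MvPolynomial.rename Fin.castSucc f) ha) 2 y)) =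
      tr hXF (2 + 2) (cup _ 2 2 x y) := by
    rw [diagonalAut_congr _ ha ha' rfl]; exact h2
  refine ⟨⟨h1', h2', h3, h4⟩, ?_⟩
  intro g h hg hh
  -- the envelope kit of the fibre over the classifying point `s = pt f`
  have hXF' : IsSmoothProjective 2 (SmoothHypersurface.hypersurface (cyclicCoverForm p f)) := hXF
  have haF : deckUnit p ∈ diagonalStabilizer (cyclicCoverForm p f) := ha
  obtain ⟨φ, B, hBs, hBn, τ, hτp, R, hτB, hφτ, hφB, hHG, hfix, hP1, hP2, hP3, hP4, hP5⟩ :=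
    𝔉.exists_envelopeKit f hf hf0 hXF' haF exists_isReal_hodgeModel_holds hodgePQ_independent_of_hodgeModel_holds
      h1' h2' h3.le (A (𝔉.pt f)) (hA (𝔉.pt f))
  -- re-type `φ` on the route's spelling of the model (`cyclicCoverForm p f` unfolds to it), so that
  -- `simp` lemmas match syntactically below
  obtain ⟨φ, rfl⟩ : ∃ φ' : bettiCohomology (fiberOver 𝔉.u (𝔉.pt f)) 2 ≃ₗ[ℚ]
      bettiCohomology (SmoothHypersurface.hypersurface
        (MvPolynomial.X (Fin.last 3) ^ p - MvPolynomial.rename Fin.castSucc f)) 2, φ' = φ := ⟨φ, rfl⟩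
  haveI := finite hXF 2
  -- the kit clauses used below, on the route's spelling of the model
  have hφτ' : ∀ x, φ (τ x) =
      pull (diagonalAut (MvPolynomial.X (Fin.last 3) ^ p - MvPolynomial.rename Fin.castSucc f) ha) 2 (φ x) := hφτ
  have hφB' : ∀ x y, B x y = tr hXF (2 + 2) (cup (SmoothHypersurface.hypersurface
      (MvPolynomial.X (Fin.last 3) ^ p - MvPolynomial.rename Fin.castSucc f)) 2 2 (φ x) (φ y)) := hφB
  have hHG' : ∀ k : bettiCohomology (fiberOver 𝔉.u (𝔉.pt f)) 2 ≃ₗ[ℚ] bettiCohomology (fiberOver 𝔉.u (𝔉.pt f)) 2,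
      k ∈ ((A (𝔉.pt f)).hodgeStructure (𝔉.isSmoothProjectiveFamily.isSmoothProjective (𝔉.pt f)) (hA (𝔉.pt f)) 2).hodgeGroup →
        (φ.symm.trans k).trans φ ∈ (hodge exists_isReal_hodgeModel_holds hXF 2).hodgeGroup := hHG
  -- the classifying point of a very general member is Hodge generic
  have hsgen : IsHodgeGenericPoint 𝔉.u 2 𝔉.locallyTrivial 𝔉.isSmoothProjectiveFamily A hA ⟨𝔉.pt f, Set.mem_univ _⟩ := by
    by_contra hns
    obtain ⟨j, hj⟩ := hcov ⟨𝔉.pt f, Set.mem_univ _⟩ hns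
    exact hG j f hf hXF (hgen j) hj
  -- CMSP 15.3.7 (i), now a THEOREM for this family (quasi-projective total space, irreducible base): a
  -- finite-index subgroup `Γ'` of the monodromy group lies in `MT(H²(𝒳_s))`
  obtain ⟨Γ', hΓ'le, hΓ'fi, hΓ'MT⟩ := (deligne_finiteIndex_monodromy_le_mumfordTateGroup_of_isQuasiProjectiveOver 𝔉.u 2 2
    𝔉.isSmoothProjectiveFamily 𝔉.isQuasiProjectiveOver_total 𝔉.isQuasiProjectiveOver 𝔉.smooth 𝔉.irreducibleSpace
    𝔉.locallyTrivial A hA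
    ⟨𝔉.pt f, Set.mem_univ _⟩ hsgen).1
  -- transport the two σ-unitary automorphisms to the fibre
  have hστ : ∀ y, τ (φ.symm y) =
      φ.symm (pull (diagonalAut (MvPolynomial.X (Fin.last 3) ^ p - MvPolynomial.rename Fin.castSucc f) ha) 2 y) :=
    fun y => by
    apply φ.injective
    rw [hφτ', LinearEquiv.apply_symm_apply, LinearEquiv.apply_symm_apply]
  have cenτ : ∀ k : bettiCohomology (SmoothHypersurface.hypersurface
        (MvPolynomial.X (Fin.last 3) ^ p - MvPolynomial.rename Fin.castSucc f)) 2 ≃ₗ[ℚ]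
      bettiCohomology (SmoothHypersurface.hypersurface
        (MvPolynomial.X (Fin.last 3) ^ p - MvPolynomial.rename Fin.castSucc f)) 2,
      (∀ x, k (pull (diagonalAut (MvPolynomial.X (Fin.last 3) ^ p - MvPolynomial.rename Fin.castSucc f) ha) 2 x) =
        pull (diagonalAut (MvPolynomial.X (Fin.last 3) ^ p - MvPolynomial.rename Fin.castSucc f) ha) 2 (k x)) →
      ∀ x, ((φ.trans k).trans φ.symm) (τ x) = τ (((φ.trans k).trans φ.symm) x) := by
    intro k hk x
    simp only [LinearEquiv.trans_apply]
    rw [hφτ', hk, hστ]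
  have cenB : ∀ k : bettiCohomology (SmoothHypersurface.hypersurface
        (MvPolynomial.X (Fin.last 3) ^ p - MvPolynomial.rename Fin.castSucc f)) 2 ≃ₗ[ℚ]
      bettiCohomology (SmoothHypersurface.hypersurface
        (MvPolynomial.X (Fin.last 3) ^ p - MvPolynomial.rename Fin.castSucc f)) 2,
      (∀ x y, tr hXF (2 + 2) (cup (SmoothHypersurface.hypersurface
          (MvPolynomial.X (Fin.last 3) ^ p - MvPolynomial.rename Fin.castSucc f)) 2 2 (k x) (k y)) =
        tr hXF (2 + 2) (cup (SmoothHypersurface.hypersurface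
          (MvPolynomial.X (Fin.last 3) ^ p - MvPolynomial.rename Fin.castSucc f)) 2 2 x y)) →
      ∀ x y, B (((φ.trans k).trans φ.symm) x) (((φ.trans k).trans φ.symm) y) = B x y := by
    intro k hk x y
    simp only [LinearEquiv.trans_apply]
    rw [hφB', LinearEquiv.apply_symm_apply, LinearEquiv.apply_symm_apply, hk, ← hφB']
  -- B2: the commutator of the transported pair lies in the ℚ-Zariski closure of `⁅Γ', Γ'⁆`
  have hc : ((φ.trans g).trans φ.symm) * ((φ.trans h).trans φ.symm) * ((φ.trans g).trans φ.symm)⁻¹ *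
      ((φ.trans h).trans φ.symm)⁻¹ ∈ glZariskiClosure ⁅Γ', Γ'⁆ :=
    CyclicUnitaryPowersLaneDCommutatorClosure.unitaryReflectionDensity_of_CT71 @hCT71
      (bettiCohomology (fiberOver 𝔉.u (𝔉.pt f)) 2) B τ p R (ratMonodromyGroup 𝔉.u 2 𝔉.locallyTrivial ⟨𝔉.pt f, Set.mem_univ _⟩)
      hp h7 hBs hBn hτp hτB hfix hP1 hP2 hP3 hP4 hP5 Γ' hΓ'le hΓ'fi
      ((φ.trans g).trans φ.symm) ((φ.trans h).trans φ.symm) (cenτ g hg.1) (cenB g hg.2) (cenτ h hh.1) (cenB h hh.2)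
  -- B1 (landed, any weight): `(⁅Γ', Γ'⁆)^Zar(ℚ) ⊆ Hg` for `Γ' ≤ MT`, the fibre's Hodge structure being polarizable
  have hcomm := mem_hodgeGroup_of_mem_glZariskiClosure_commutator
    ((A (𝔉.pt f)).hodgeStructure (𝔉.isSmoothProjectiveFamily.isSmoothProjective (𝔉.pt f)) (hA (𝔉.pt f)) 2)
    (smoothProjective_hodgeStructure_isPolarizable_holds (𝔉.isSmoothProjectiveFamily.isSmoothProjective (𝔉.pt f))
      (A (𝔉.pt f)) (hA (𝔉.pt f)) 2) hΓ'MT hc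
  -- transport back to `H²(X_F;ℚ)` along `φ`
  have hback := hHG' _ hcomm
  have hid : (φ.symm.trans (((φ.trans g).trans φ.symm) * ((φ.trans h).trans φ.symm) * ((φ.trans g).trans φ.symm)⁻¹ *
      ((φ.trans h).trans φ.symm)⁻¹)).trans φ = g * h * g⁻¹ * h⁻¹ := by
    ext x
    simp only [LinearEquiv.mul_apply, LinearEquiv.trans_apply, LinearEquiv.coe_inv, LinearEquiv.symm_trans_apply,
      LinearEquiv.symm_symm, LinearEquiv.apply_symm_apply]
  rw [← hid]
  exact hback


/-- **K1 ⟸ {Carlson–Toledo family at primes, PG, B2, CDK}** (the junction fed with `cyclicDeckHodge_of_printNumbers` and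
the PROVED density theorem `carlsonToledo1999_unitaryReflection_zariskiDense_holds`).
[cite: CarlsonToledo1999, §7 Thm. 7.1] [cite: Arapura2012, §17.3 (17.3.1)] [cite: EisenbudHarris2016, Example 5.24] -/
theorem veryGeneralDeckCommutatorsInHg_of_prime_family_printNumbers
    (hCT : ∀ ⦃p : ℕ⦄, p.Prime → 7 ≤ p → Nonempty (CarlsonToledoFamily p))
    (hA : Arapura2012_hypersurface_geometricGenus) (hB : EisenbudHarris2016_surface_secondBettiNumber)
    (hCDK : cmsp_nonHodgeGenericPoints_countable_algebraic_cover) :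
    Summit.HodgeConjecture.HodgeConjecture.Theses.CyclicUnitaryPowers.VeryGeneralDeckCommutatorsInHg :=
  veryGeneralDeckCommutatorsInHg_of_deckHodge_prime hCT (cyclicDeckHodge_of_printNumbers hA hB)
    carlsonToledo1999_unitaryReflection_zariskiDense_holds @hCDK

/-- **K1-A ⟸ {F1°, PG, B2, CDK}.** `VeryGeneralDeckCommutatorsInHg` from the printed local Picard–Lefschetz statement F1°
(`carlsonToledo1999_nodalMeridianMonodromy_isCyclicReflection`, CT99 §6 Prop at a one-nodal centre; it yields the PL
package and hence the Carlson–Toledo family at every odd `p ≥ 7`), the two numerical facts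
`Arapura2012_hypersurface_geometricGenus` / `EisenbudHarris2016_surface_secondBettiNumber` (replacing the eigen-Hodge
binder CT2), and the Cattani–Deligne–Kaplan cover. CONDITIONAL; rung F-H1 not moved.
[cite: CarlsonToledo1999, §5, §6 (kdoublept) and Proposition, §7 Thm. 7.1] [cite: CattaniDeligneKaplan1995, Thm. 1.1 and Cor. 1.2]
[cite: Arapura2012, §17.3 (17.3.1)] [cite: EisenbudHarris2016, Example 5.24] -/
theorem veryGeneralDeckCommutatorsInHg_of_nodalMeridian_printNumbers
    (H1 : carlsonToledo1999_nodalMeridianMonodromy_isCyclicReflection)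
    (hA : Arapura2012_hypersurface_geometricGenus) (hB : EisenbudHarris2016_surface_secondBettiNumber)
    (hCDK : cmsp_nonHodgeGenericPoints_countable_algebraic_cover) :
    Summit.HodgeConjecture.HodgeConjecture.Theses.CyclicUnitaryPowers.VeryGeneralDeckCommutatorsInHg :=
  veryGeneralDeckCommutatorsInHg_of_prime_family_printNumbers
    (fun p hp h7 ↦ nonempty_carlsonToledoFamily_of_cyclicReflectionSystem
      (CyclicUnitaryPowersPLPackageOfNodalMeridian.carlsonToledo1999_cyclicReflectionSystem_of_nodalMeridian H1)
      (hp.odd_of_ne_two (by omega)) (by omega))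
    hA hB @hCDK

/-- **The rung-F-H1 leaf `CyclicSurfacePowersHodge` (stmt-HodgeConjecture-19543) modulo the same four facts** (K1 above
composed with the PROVED crux K2 `PowersHodgeOfDeckCommutators` and support S,
`cyclicSurfacePowersHodge_of_veryGeneralDeckCommutatorsInHg`). CONDITIONAL; rung F-H1 not moved.
[cite: CarlsonToledo1999, §5, §6 Proposition, §7 Thm. 7.1] [cite: CattaniDeligneKaplan1995, Thm. 1.1 and Cor. 1.2] -/
theorem cyclicSurfacePowersHodge_of_nodalMeridian_printNumbers
    (H1 : carlsonToledo1999_nodalMeridianMonodromy_isCyclicReflection)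
    (hA : Arapura2012_hypersurface_geometricGenus) (hB : EisenbudHarris2016_surface_secondBettiNumber)
    (hCDK : cmsp_nonHodgeGenericPoints_countable_algebraic_cover) :
    Summit.HodgeConjecture.HodgeConjecture.Theses.CyclicUnitaryPowers.CyclicSurfacePowersHodge :=
  CyclicUnitaryPowersCyclicSurfacePowersHodge.cyclicSurfacePowersHodge_of_veryGeneralDeckCommutatorsInHg
    (veryGeneralDeckCommutatorsInHg_of_nodalMeridian_printNumbers H1 hA hB @hCDK)

end Summit.HodgeConjecture.HodgeConjecture.Theorems.CyclicUnitaryPowersK1OfPrintNumbers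

end
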